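import Literature.MathematicalPhysics.QuantumFieldTheory.Balaban1983to89.B9Eq325RLipschitzSqrt
import Literature.MathematicalPhysics.QuantumFieldTheory.Balaban1983to89.B9Eq325ProjFormulaTower

/-!
# `Balaban1983to89.B9Eq325RLipschitzSqrtTower` — T. Bałaban, *Propagators for lattice gauge theories in a background field*, Commun. Math. Phys.
# **99** (1985) 389–434 [Balaban1985BackgroundPropagators] p. 403 with (3.21)∕(3.25) p. 394 AT `k = n+1` AVERAGING LEVELS: **THE `κ^{−1∕2}` ROAD FOR
# THE `k`-LEVEL GAUGE-FIXING PROJECTION — `‖R_{n+1}(U)f − R_{n+1}(V)f‖ ≤ δ_A·(1∕(√κ₀ − δ_A) + 1∕√κ₀)·‖f‖`, `δ_A = θ_G M_Q + g θ_Q`, FOR THE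
# pub-balaban NE9 CHAIN's `B9Eq326OperatorTower.RofUk`, MODULO THE FOUR TOWER LETTERS DISPLAYED** — ne9-leaf-01's one-step
# `B9Eq325RLipschitzSqrt` §2 ONE STOREY UP on the NE9 owner's `B9Eq324DeltaPrimeATower` ∕ `B9Eq325ProjFormulaTower` ((3.24)–(3.25) at `k` levels, t4-ne9-p1 gen 85); the `hR`-slot SHAPE of the
# owner's `k`-level host `B9Thm311SmallFieldCoercivityTowerScaled` (route R2′ STEP B7′ sub-step S3 in the tower currency)

statement-level skeleton of published theorems with citation tags; proofs where landed; nothing here is a claim about the Yang–Mills mass gap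

PDF held: `paper:balaban1985-cmp99-background-propagators` (journal page = PDF page + 388), pp. 394, 402–403 — through the verbatim quotations of
`B9Eq325RLipschitzSqrt` (ne9-leaf-01 gen 79) and `B9Eq325ProjFormula` (ne9-leaf-06 gen 63).

CITATION HEADER (lean-in-tree rule 2026-08-18).  Audit cell `pub-balaban`, sub-cell `t4`, NE9 crux team (2): LEAF PROVER 04
(`b2b-balaban-t4-ne9-formalise-leaf-04` gen 75), INTENT-2.  Route R2′ STEP B7′ sub-step S3 («`‖R(U) − R(1)‖ ≤ C_R·α`», `t4/ROUTES-NE9.md` v13.19 ∕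
v13.21 «S3 ↦ S3ᵗ» ∕ v13.25 (ii) «`‖R(U) − R(1)‖` COSTS `κ(1)^{−1∕2}`») for print's `k`-th-step operator: the owner's host
`B9Thm311SmallFieldCoercivityTowerScaled.exists_strong_coercive_of_scaled_letters_tower` (gen 84) DISPLAYS `hR : ‖R_{n+1}(U)x − R_{n+1}(1)x‖ ≤ C_R·α·‖x‖`
and records «S3 (`C_R`: open)».  THIS FILE gives that letter's SHAPE at `k` levels with `C_R·α = δ_A(1∕(√κ₀ − δ_A) + 1∕√κ₀)` an explicit function of
FOUR tower letters (`θ_G, M_Q, θ_Q, g`) and ONE flat-reference floor `κ₀` — the letters themselves are the subject of separate files (ne9-leaf-02's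
`B9Eq319QprimeTowerLipschitzL2` for `θ_Q`; the flat one-step floors at block size `L^{n+1}` through `B9Eq324DeltaPrimeATower` §3 ∕ `B9Eq325ProjFormulaTower.QGGQk_one_eq_oneStep` for `κ₀`, `g`;
a `k`-level form-relative Green letter for `θ_G`).

THE PRINT (verbatim, as quoted in `B9Eq325RLipschitzSqrt`).  p. 403 l. 27–28: *«These results imply that the operators R(U), P(U) = I − R(U) extend
analytically to the domain (3.37) and satisfy the same bounds»*; (3.25) p. 394: *«Rf = (I − G′Q′*(Q′G′²Q′*)⁻¹Q′G′)f, where G′ = G′(U) = (Δ′_a)⁻¹.»*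
Print's `Q′` on p. 394 IS the `k`-level composite `Q′_k(U)` ((3.19), (3.24): «Σ_{j=0}^{k}»); `B9Eq325RLipschitzSqrt` was the case `k = 1`.

WHAT IS PROVED (sorry-free; 0 `def`; [folklore] Hilbert-space geometry BY NAME — ne9-leaf-01's abstract `norm_starProjection_sub_le_of_letters` — at
the owner's `k`-level letters; nothing of [B9] asserted hypothesis-free).
* **`GQk_mem_orthogonal_and_gen`** — for a background `U` of `T_{L^{n+1} m}` with `hRS` and the displayed positivity `hpos′` of `Δ′_a(U)`
  (`B9Eq324DeltaPrimeATower.laplacePrimeAk`): `G′_{n+1}(U)Q̃′_{n+1}(U)†x ⊥ Δ^η_U N(Q′_{n+1}(U))` and `f − R_{n+1}(U)f ∈ range(G′_{n+1}(U)Q̃′_{n+1}(U)†)` —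
  `B9Eq325ProjFormula.inner_formula_rem_eq_zero` and the owner's `RofUk_eq_formula` read as the `horth`∕`hgen` hypotheses of leaf-01's §1.
* **`norm_RofUk_sub_RofUk_le_sqrt`** — for two backgrounds `U`, `V` of `T_{L^{n+1} m}` (`hRSU`, `hRSV`, `hposU`, `hposV`) and FIVE DISPLAYED letters:
  the Gram floor `κ₀‖ψ‖² ≤ re⟪ψ, Q̃′_{n+1}(V)G′_{n+1}(V)²Q̃′_{n+1}(V)†ψ⟫` AT THE REFERENCE `V` ONLY, `‖G′_{n+1}(U)y − G′_{n+1}(V)y‖ ≤ θ_G‖y‖`,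
  `‖Q̃′_{n+1}(U)v‖ ≤ M_Q‖v‖`, `‖Q̃′_{n+1}(U)v − Q̃′_{n+1}(V)v‖ ≤ θ_Q‖v‖`, `‖G′_{n+1}(V)y‖ ≤ g‖y‖`, in the window `δ_A := θ_G M_Q + g θ_Q < √κ₀`:
  **`‖R_{n+1}(U)f − R_{n+1}(V)f‖ ≤ (δ_A∕(√κ₀ − δ_A) + δ_A∕√κ₀)·‖f‖`** for `B9Eq326OperatorTower.RofUk`.
* **`norm_RofUk_sub_RofUk_one_le_sqrt`** — the same at the FLAT reference `V ≡ 1` with `hRSV`, `hposV` DISCHARGED (`B9Eq325ProjFormulaTower.adTransportW_adjoint_one_tower`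
  ∕ `B9Eq324DeltaPrimeATower.laplacePrimeAk_one_pos`: `η ≠ 0`, `a′ > 0`): literally the host's `hR` shape `‖R_{n+1}(U)x − R_{n+1}(1)x‖ ≤ C·‖x‖` modulo the five letters.
MODEL ∕ DECLARED READINGS.  (M1) as `B9Eq324DeltaPrimeATower` (fine torus `T_{L^{n+1} m}`, unit torus `T_m`, weights `c₀`∕`c₁`, fibre `W` along `φ`, scalar
`η⁻¹`, one number `a′`).  (M2) the five letters are DISPLAYED: this file asserts NO value for `κ₀, θ_G, M_Q, θ_Q, g`; whether `C_R` is `(η, L, m, k)`-free is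
EXACTLY the question whether the letters are (the cell's non-uniformity ledger, TOWER-SPECIES-PLAN v2 §3).  (M3) NOT HERE: print's analyticity in `U`
(p. 403), the decay (3.42)–(3.49), the gauge step (3.35)–(3.37).
HONEST SCOPE.  [folklore] port one storey up; the `R`-letter SHAPE, not its size; «NE9 ⇐ the named binders»; NE9 NOT PRINTED ∕ NOT PROVED; NOT summit
progress (cell pub-balaban: row NE9 WALLED ON A MODEL; spine PROVED 0∕9; rung (B)+1 on a finite T⁴ — NOT infinite volume, NOT mass gap, NOT BetaPertH, NOT
Clay).  NEW file importing `B9Eq325RLipschitzSqrt` (ne9-leaf-01) + `B9Eq325ProjFormulaTower` (NE9 owner); nothing modified.  Net new unproved facts: 0.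
-/

noncomputable section

open scoped InnerProductSpace ComplexConjugate BigOperators

namespace Literature.MathematicalPhysics.QuantumFieldTheory.Balaban1983to89.B9Eq325RLipschitzSqrtTower

open B4Sect5Torus (TSite)
open B9SectCLatticeCarrier (Bond)
open B9Eq311L2Pairing (WL2)
open B11Eq103H1Complex (SiteL2K projR greenK apply_greenK covLaplaceSiteK)
open B9Eq310HessianOperator (adTransportW)
open B9Eq315QTower (towerP)
open B9Eq326OperatorTower (QprimeTowerW RofUk)
open B9Eq325ProjFormula (inner_formula_rem_eq_zero inner_qggq_eq)
open B9Eq324DeltaPrimeATower (laplacePrimeAk laplacePrimeAk_apply_of_ker GpOfUk laplacePrimeAk_isSymmetric laplacePrimeAk_one_pos)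
open B9Eq325ProjFormulaTower (QGGQk_pos RofUk_eq_formula adTransportW_adjoint_one_tower)
open B9Eq325RLipschitzSqrt (norm_starProjection_sub_le_of_letters)

section Chain

variable {d : ℕ} (L : ℕ) [NeZero L] (m : Fin d → ℕ) [∀ i, NeZero (m i)] (n : ℕ)
  {𝔸 : Type*} [NormedRing 𝔸] [NormedAlgebra ℂ 𝔸] [CompleteSpace 𝔸]
  {W : Type*} [NormedAddCommGroup W] [InnerProductSpace ℂ W] [FiniteDimensional ℂ W] (φ : W ≃ₗ[ℂ] 𝔸) (c₀ : ℝ) [Fact (0 < c₀)]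
  (η : ℝ) (U V : Bond d (towerP L m (n + 1)) → 𝔸ˣ) (c₁ : ℝ) [Fact (0 < c₁)] (a' : ℝ)
  (hRSU : ∀ (b : Bond d (towerP L m (n + 1))) (v u : W), ⟪adTransportW φ U b v, u⟫_ℂ = ⟪v, adTransportW φ (fun b => (U b)⁻¹) b u⟫_ℂ)
  (hRSV : ∀ (b : Bond d (towerP L m (n + 1))) (v u : W), ⟪adTransportW φ V b v, u⟫_ℂ = ⟪v, adTransportW φ (fun b => (V b)⁻¹) b u⟫_ℂ)
  (hposU : ∀ x : SiteL2K ℂ d (towerP L m (n + 1)) c₀ W, x ≠ 0 → 0 < RCLike.re ⟪x, laplacePrimeAk L m n φ η U a' (c₁ := c₁) x⟫_ℂ)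
  (hposV : ∀ x : SiteL2K ℂ d (towerP L m (n + 1)) c₀ W, x ≠ 0 → 0 < RCLike.re ⟪x, laplacePrimeAk L m n φ η V a' (c₁ := c₁) x⟫_ℂ)

include hRSU in
/-- **`G′_{n+1}(U)Q̃′_{n+1}(U)†x ⊥ Δ^η_U N(Q′_{n+1}(U))` and `f − R_{n+1}(U)f ∈ range(G′_{n+1}(U)Q̃′_{n+1}(U)†)`** — the two range facts of (3.25) for the
chain's `k`-level `R_{n+1}(U)` (`inner_formula_rem_eq_zero` at the tower letters and the owner's `RofUk_eq_formula`, read as the hypotheses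
`horth`∕`hgen` of ne9-leaf-01's §1). [cite: Balaban1985BackgroundPropagators, (3.21) p.394, (3.25) p.394] -/
theorem GQk_mem_orthogonal_and_gen :
    (∀ x : SiteL2K ℂ d m c₁ W, (GpOfUk L m n φ η U a' (c₁ := c₁) hposU ∘ₗ
        LinearMap.adjoint ((WL2.linearEquiv ℂ ℂ (fun _ : TSite d m => c₁)).symm.toLinearMap ∘ₗ QprimeTowerW L m n φ U (c₀ := c₀))) x ∈
      ((LinearMap.ker (QprimeTowerW L m n φ U (c₀ := c₀))).map
        (covLaplaceSiteK ((η : ℂ))⁻¹ (adTransportW φ U) (adTransportW φ fun b => (U b)⁻¹)))ᗮ) ∧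
    (∀ f : SiteL2K ℂ d (towerP L m (n + 1)) c₀ W, ∃ x : SiteL2K ℂ d m c₁ W, f - RofUk L m n φ η U (c₀ := c₀) f =
      (GpOfUk L m n φ η U a' (c₁ := c₁) hposU ∘ₗ
        LinearMap.adjoint ((WL2.linearEquiv ℂ ℂ (fun _ : TSite d m => c₁)).symm.toLinearMap ∘ₗ QprimeTowerW L m n φ U (c₀ := c₀))) x) := by
  refine ⟨fun x => ?_, fun f => ?_⟩
  · rw [Submodule.mem_orthogonal]
    intro ω hω
    rw [inner_eq_zero_symm, LinearMap.comp_apply]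
    have hker' : ∀ l : SiteL2K ℂ d (towerP L m (n + 1)) c₀ W, QprimeTowerW L m n φ U (c₀ := c₀) l = 0 →
        ((WL2.linearEquiv ℂ ℂ (fun _ : TSite d m => c₁)).symm.toLinearMap ∘ₗ QprimeTowerW L m n φ U (c₀ := c₀)) l = 0 := fun l hl => by
      rw [LinearMap.comp_apply, hl, map_zero]
    exact inner_formula_rem_eq_zero (𝕜 := ℂ) _ (laplacePrimeAk L m n φ η U a' (c₁ := c₁)) (GpOfUk L m n φ η U a' (c₁ := c₁) hposU)
      (QprimeTowerW L m n φ U (c₀ := c₀)) ((WL2.linearEquiv ℂ ℂ (fun _ : TSite d m => c₁)).symm.toLinearMap ∘ₗ QprimeTowerW L m n φ U (c₀ := c₀))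
      (LinearMap.adjoint ((WL2.linearEquiv ℂ ℂ (fun _ : TSite d m => c₁)).symm.toLinearMap ∘ₗ QprimeTowerW L m n φ U (c₀ := c₀)))
      hker' (fun l hl => laplacePrimeAk_apply_of_ker L m n φ η U a' hl) (laplacePrimeAk_isSymmetric L m n φ η U a' hRSU)
      (fun x ψ => (LinearMap.adjoint_inner_right _ x ψ).symm) (fun x => apply_greenK hposU x) x ω hω
  · refine ⟨greenK _ (QGGQk_pos L m n φ c₀ η U c₁ a' hRSU hposU)
      (((WL2.linearEquiv ℂ ℂ (fun _ : TSite d m => c₁)).symm.toLinearMap ∘ₗ QprimeTowerW L m n φ U (c₀ := c₀))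
        (GpOfUk L m n φ η U a' (c₁ := c₁) hposU f)), ?_⟩
    rw [RofUk_eq_formula L m n φ c₀ η U c₁ a' hRSU hposU f, sub_sub_cancel]
    rfl

include hRSU hRSV in
/-- **THE `κ^{−1∕2}` ROAD AT `k = n+1` LEVELS**: for two backgrounds `U`, `V` of `T_{L^{n+1} m}` with mutually adjoint transporters and the displayed
positivities of `Δ′_{a′}` ((3.24) at `k` levels), and FIVE letters — a coercivity `κ₀` of the Gram operator `K′(V) = Q̃′_{n+1}(V)G′_{n+1}(V)²Q̃′_{n+1}(V)†`
at the REFERENCE background `V` IN FORM, `‖G′_{n+1}(U)y − G′_{n+1}(V)y‖ ≤ θ_G‖y‖`, `‖Q̃′_{n+1}(U)v‖ ≤ M_Q‖v‖`, `‖Q̃′_{n+1}(U)v − Q̃′_{n+1}(V)v‖ ≤ θ_Q‖v‖`,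
`‖G′_{n+1}(V)y‖ ≤ g‖y‖` — in the window `δ_A := θ_G M_Q + g θ_Q < √κ₀`:  **`‖R_{n+1}(U)f − R_{n+1}(V)f‖ ≤ (δ_A∕(√κ₀ − δ_A) + δ_A∕√κ₀)·‖f‖`.**
ne9-leaf-01's `norm_starProjection_sub_le_of_letters` at `K_i = Δ N(Q′_{n+1})`, `A_i = G′_{n+1}Q̃′_{n+1}†` (`GQk_mem_orthogonal_and_gen`), `s_V = √κ₀`
(`inner_qggq_eq`). [cite: Balaban1985BackgroundPropagators, p.403, (3.25) p.394, (3.63)–(3.68) pp.402–403, Thm 3.11 p.416] -/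
theorem norm_RofUk_sub_RofUk_le_sqrt {κ₀ θG MQ θQ g : ℝ} (hκ₀ : 0 < κ₀) (hθG : 0 ≤ θG) (hMQ : 0 ≤ MQ) (hθQ : 0 ≤ θQ) (hg : 0 ≤ g)
    (hκ : ∀ ψ : SiteL2K ℂ d m c₁ W, κ₀ * ‖ψ‖ ^ 2 ≤ RCLike.re ⟪ψ,
      (((WL2.linearEquiv ℂ ℂ (fun _ : TSite d m => c₁)).symm.toLinearMap ∘ₗ QprimeTowerW L m n φ V (c₀ := c₀)) ∘ₗ
        GpOfUk L m n φ η V a' (c₁ := c₁) hposV ∘ₗ GpOfUk L m n φ η V a' (c₁ := c₁) hposV ∘ₗ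
        LinearMap.adjoint ((WL2.linearEquiv ℂ ℂ (fun _ : TSite d m => c₁)).symm.toLinearMap ∘ₗ QprimeTowerW L m n φ V (c₀ := c₀))) ψ⟫_ℂ)
    (hG : ∀ y, ‖GpOfUk L m n φ η U a' (c₁ := c₁) hposU y - GpOfUk L m n φ η V a' (c₁ := c₁) hposV y‖ ≤ θG * ‖y‖)
    (hQU : ∀ v, ‖((WL2.linearEquiv ℂ ℂ (fun _ : TSite d m => c₁)).symm.toLinearMap ∘ₗ QprimeTowerW L m n φ U (c₀ := c₀)) v‖ ≤ MQ * ‖v‖)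
    (hdQ : ∀ v, ‖((WL2.linearEquiv ℂ ℂ (fun _ : TSite d m => c₁)).symm.toLinearMap ∘ₗ QprimeTowerW L m n φ U (c₀ := c₀)) v -
      ((WL2.linearEquiv ℂ ℂ (fun _ : TSite d m => c₁)).symm.toLinearMap ∘ₗ QprimeTowerW L m n φ V (c₀ := c₀)) v‖ ≤ θQ * ‖v‖)
    (hGV : ∀ y, ‖GpOfUk L m n φ η V a' (c₁ := c₁) hposV y‖ ≤ g * ‖y‖)
    (hwin : θG * MQ + g * θQ < Real.sqrt κ₀) (f : SiteL2K ℂ d (towerP L m (n + 1)) c₀ W) :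
    ‖RofUk L m n φ η U (c₀ := c₀) f - RofUk L m n φ η V (c₀ := c₀) f‖ ≤
      ((θG * MQ + g * θQ) / (Real.sqrt κ₀ - (θG * MQ + g * θQ)) + (θG * MQ + g * θQ) / Real.sqrt κ₀) * ‖f‖ := by
  haveI : CompleteSpace ((LinearMap.ker (QprimeTowerW L m n φ U (c₀ := c₀))).map
      (covLaplaceSiteK ((η : ℂ))⁻¹ (adTransportW φ U) (adTransportW φ fun b => (U b)⁻¹))) := FiniteDimensional.complete ℂ _
  haveI : CompleteSpace ((LinearMap.ker (QprimeTowerW L m n φ V (c₀ := c₀))).map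
      (covLaplaceSiteK ((η : ℂ))⁻¹ (adTransportW φ V) (adTransportW φ fun b => (V b)⁻¹))) := FiniteDimensional.complete ℂ _
  -- `R_{n+1}(U) = starProjection (Δ_U N(Q′_{n+1}(U)))` by definition
  have hRU : RofUk L m n φ η U (c₀ := c₀) f = ((LinearMap.ker (QprimeTowerW L m n φ U (c₀ := c₀))).map
      (covLaplaceSiteK ((η : ℂ))⁻¹ (adTransportW φ U) (adTransportW φ fun b => (U b)⁻¹))).starProjection f := by
    unfold RofUk B11Eq103H1Complex.RLatticeK projR; rfl
  have hRV : RofUk L m n φ η V (c₀ := c₀) f = ((LinearMap.ker (QprimeTowerW L m n φ V (c₀ := c₀))).map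
      (covLaplaceSiteK ((η : ℂ))⁻¹ (adTransportW φ V) (adTransportW φ fun b => (V b)⁻¹))).starProjection f := by
    unfold RofUk B11Eq103H1Complex.RLatticeK projR; rfl
  obtain ⟨horthU, hgenU⟩ := GQk_mem_orthogonal_and_gen L m n φ c₀ η U c₁ a' hRSU hposU
  obtain ⟨horthV, hgenV⟩ := GQk_mem_orthogonal_and_gen L m n φ c₀ η V c₁ a' hRSV hposV
  -- the reference coercivity on the Gram side: `κ₀‖x‖² ≤ re⟪x, K′(V)x⟫ = ‖G′(V)Q̃′(V)†x‖²`
  have hκ' : ∀ x : SiteL2K ℂ d m c₁ W, κ₀ * ‖x‖ ^ 2 ≤ ‖GpOfUk L m n φ η V a' (c₁ := c₁) hposV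
      (LinearMap.adjoint ((WL2.linearEquiv ℂ ℂ (fun _ : TSite d m => c₁)).symm.toLinearMap ∘ₗ QprimeTowerW L m n φ V (c₀ := c₀)) x)‖ ^ 2 := by
    intro x
    have h := hκ x
    have e := inner_qggq_eq ((WL2.linearEquiv ℂ ℂ (fun _ : TSite d m => c₁)).symm.toLinearMap ∘ₗ QprimeTowerW L m n φ V (c₀ := c₀))
      (laplacePrimeAk_isSymmetric L m n φ η V a' hRSV) hposV x
    simp only [LinearMap.comp_apply] at h e
    unfold GpOfUk at h ⊢
    rw [e, ← RCLike.ofReal_pow, RCLike.ofReal_re] at h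
    exact h
  -- the range facts read at the `starProjection`
  have hgenU' : ∀ v, ∃ x : SiteL2K ℂ d m c₁ W, v - ((LinearMap.ker (QprimeTowerW L m n φ U (c₀ := c₀))).map
      (covLaplaceSiteK ((η : ℂ))⁻¹ (adTransportW φ U) (adTransportW φ fun b => (U b)⁻¹))).starProjection v =
      (GpOfUk L m n φ η U a' (c₁ := c₁) hposU ∘ₗ
        LinearMap.adjoint ((WL2.linearEquiv ℂ ℂ (fun _ : TSite d m => c₁)).symm.toLinearMap ∘ₗ QprimeTowerW L m n φ U (c₀ := c₀))) x := by
    intro v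
    obtain ⟨x, hx⟩ := hgenU v
    refine ⟨x, ?_⟩
    rw [← hx]
    unfold RofUk B11Eq103H1Complex.RLatticeK projR; rfl
  have hgenV' : ∀ v, ∃ x : SiteL2K ℂ d m c₁ W, v - ((LinearMap.ker (QprimeTowerW L m n φ V (c₀ := c₀))).map
      (covLaplaceSiteK ((η : ℂ))⁻¹ (adTransportW φ V) (adTransportW φ fun b => (V b)⁻¹))).starProjection v =
      (GpOfUk L m n φ η V a' (c₁ := c₁) hposV ∘ₗ
        LinearMap.adjoint ((WL2.linearEquiv ℂ ℂ (fun _ : TSite d m => c₁)).symm.toLinearMap ∘ₗ QprimeTowerW L m n φ V (c₀ := c₀))) x := by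
    intro v
    obtain ⟨x, hx⟩ := hgenV v
    refine ⟨x, ?_⟩
    rw [← hx]
    unfold RofUk B11Eq103H1Complex.RLatticeK projR; rfl
  rw [hRU, hRV]
  exact norm_starProjection_sub_le_of_letters _ _ _ _ _ _ hκ₀ hθG hMQ hθQ hg horthU horthV hgenU' hgenV' hκ' hG hQU hdQ hGV hwin f

end Chain

/-! ## §2 At the flat reference `V ≡ 1`: the host's `hR` shape `‖R_{n+1}(U)x − R_{n+1}(1)x‖ ≤ C·‖x‖` modulo the letters -/

section Flat

variable {d : ℕ} (L : ℕ) [NeZero L] (m : Fin d → ℕ) [∀ i, NeZero (m i)] (n : ℕ)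
  {𝔸 : Type*} [NormedRing 𝔸] [NormedAlgebra ℂ 𝔸] [CompleteSpace 𝔸]
  {W : Type*} [NormedAddCommGroup W] [InnerProductSpace ℂ W] [FiniteDimensional ℂ W] (φ : W ≃ₗ[ℂ] 𝔸) (c₀ : ℝ) [Fact (0 < c₀)]
  (η : ℝ) (U : Bond d (towerP L m (n + 1)) → 𝔸ˣ) (c₁ : ℝ) [Fact (0 < c₁)] (a' : ℝ) (hη : η ≠ 0) (ha : 0 < a')
  (hRSU : ∀ (b : Bond d (towerP L m (n + 1))) (v u : W), ⟪adTransportW φ U b v, u⟫_ℂ = ⟪v, adTransportW φ (fun b => (U b)⁻¹) b u⟫_ℂ)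
  (hposU : ∀ x : SiteL2K ℂ d (towerP L m (n + 1)) c₀ W, x ≠ 0 → 0 < RCLike.re ⟪x, laplacePrimeAk L m n φ η U a' (c₁ := c₁) x⟫_ℂ)

include hRSU in
/-- **THE TOWER `R`-LETTER AGAINST THE FLAT REFERENCE, MODULO LETTERS**: with `G′_{n+1}(1)` at its letter-free positivity
(`B9Eq324DeltaPrimeATower.laplacePrimeAk_one_pos`, `η ≠ 0`, `a′ > 0`) and the flat transport trivially self-adjoint (`adTransportW_adjoint_one_tower`), the five
displayed letters `κ₀` (Gram floor of `Q̃′_{n+1}(1)G′_{n+1}(1)²Q̃′_{n+1}(1)†`), `θ_G`, `M_Q`, `θ_Q`, `g` in the window `δ_A = θ_G M_Q + g θ_Q < √κ₀` give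
**`‖R_{n+1}(U)f − R_{n+1}(1)f‖ ≤ (δ_A∕(√κ₀ − δ_A) + δ_A∕√κ₀)·‖f‖`** — the shape of the `hR` slot of the owner's
`B9Thm311SmallFieldCoercivityTowerScaled.exists_strong_coercive_of_scaled_letters_tower` (same `RofUk` terms on both sides).
[cite: Balaban1985BackgroundPropagators, p.403, (3.25) p.394, Thm 3.11 p.416] -/
theorem norm_RofUk_sub_RofUk_one_le_sqrt {κ₀ θG MQ θQ g : ℝ} (hκ₀ : 0 < κ₀) (hθG : 0 ≤ θG) (hMQ : 0 ≤ MQ) (hθQ : 0 ≤ θQ) (hg : 0 ≤ g)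
    (hκ : ∀ ψ : SiteL2K ℂ d m c₁ W, κ₀ * ‖ψ‖ ^ 2 ≤ RCLike.re ⟪ψ,
      (((WL2.linearEquiv ℂ ℂ (fun _ : TSite d m => c₁)).symm.toLinearMap ∘ₗ
          QprimeTowerW L m n φ (fun _ : Bond d (towerP L m (n + 1)) => (1 : 𝔸ˣ)) (c₀ := c₀)) ∘ₗ
        GpOfUk L m n φ η (fun _ : Bond d (towerP L m (n + 1)) => (1 : 𝔸ˣ)) a' (c₁ := c₁) (laplacePrimeAk_one_pos L m n φ η a' hη ha) ∘ₗ
        GpOfUk L m n φ η (fun _ : Bond d (towerP L m (n + 1)) => (1 : 𝔸ˣ)) a' (c₁ := c₁) (laplacePrimeAk_one_pos L m n φ η a' hη ha) ∘ₗ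
        LinearMap.adjoint ((WL2.linearEquiv ℂ ℂ (fun _ : TSite d m => c₁)).symm.toLinearMap ∘ₗ
          QprimeTowerW L m n φ (fun _ : Bond d (towerP L m (n + 1)) => (1 : 𝔸ˣ)) (c₀ := c₀))) ψ⟫_ℂ)
    (hG : ∀ y : SiteL2K ℂ d (towerP L m (n + 1)) c₀ W, ‖GpOfUk L m n φ η U a' (c₁ := c₁) hposU y -
      GpOfUk L m n φ η (fun _ : Bond d (towerP L m (n + 1)) => (1 : 𝔸ˣ)) a' (c₁ := c₁) (laplacePrimeAk_one_pos L m n φ η a' hη ha) y‖ ≤ θG * ‖y‖)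
    (hQU : ∀ v, ‖((WL2.linearEquiv ℂ ℂ (fun _ : TSite d m => c₁)).symm.toLinearMap ∘ₗ QprimeTowerW L m n φ U (c₀ := c₀)) v‖ ≤ MQ * ‖v‖)
    (hdQ : ∀ v, ‖((WL2.linearEquiv ℂ ℂ (fun _ : TSite d m => c₁)).symm.toLinearMap ∘ₗ QprimeTowerW L m n φ U (c₀ := c₀)) v -
      ((WL2.linearEquiv ℂ ℂ (fun _ : TSite d m => c₁)).symm.toLinearMap ∘ₗ
        QprimeTowerW L m n φ (fun _ : Bond d (towerP L m (n + 1)) => (1 : 𝔸ˣ)) (c₀ := c₀)) v‖ ≤ θQ * ‖v‖)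
    (hGV : ∀ y : SiteL2K ℂ d (towerP L m (n + 1)) c₀ W,
      ‖GpOfUk L m n φ η (fun _ : Bond d (towerP L m (n + 1)) => (1 : 𝔸ˣ)) a' (c₁ := c₁) (laplacePrimeAk_one_pos L m n φ η a' hη ha) y‖ ≤
      g * ‖y‖)
    (hwin : θG * MQ + g * θQ < Real.sqrt κ₀) (f : SiteL2K ℂ d (towerP L m (n + 1)) c₀ W) :
    ‖RofUk L m n φ η U (c₀ := c₀) f - RofUk L m n φ η (fun _ : Bond d (towerP L m (n + 1)) => (1 : 𝔸ˣ)) (c₀ := c₀) f‖ ≤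
      ((θG * MQ + g * θQ) / (Real.sqrt κ₀ - (θG * MQ + g * θQ)) + (θG * MQ + g * θQ) / Real.sqrt κ₀) * ‖f‖ :=
  norm_RofUk_sub_RofUk_le_sqrt L m n φ c₀ η U _ c₁ a' hRSU (adTransportW_adjoint_one_tower L m n φ) hposU _ hκ₀ hθG hMQ hθQ hg hκ hG hQU hdQ hGV hwin f

end Flat

end Literature.MathematicalPhysics.QuantumFieldTheory.Balaban1983to89.B9Eq325RLipschitzSqrtTower

end
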